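import Literature.Analysis.FluidPDE.TorusLinearisedNSShearModesSuperposition
import Literature.Analysis.FunctionSpaces.TorusLinearisedNSTruncatedData
import Literature.Analysis.FunctionSpaces.TorusAxisAverage
import Literature.Analysis.FunctionSpaces.TorusFourierModes
import HarnessLib

/-!
# Linearised Navier–Stokes at an axis-invariant carrier: reduction of `L²` growth bounds for
# streamwise-only data to ONE streamwise harmonic

Analysis/FluidPDE proof file (theorems only; no definitions, no named facts), the last piece of the
per-streamwise-mode reduction begun in `TorusLinearisedNSShearModesSuperposition` (finite superpositions)
and `FunctionSpaces/TorusLinearisedNSTruncatedData` (band-limited data suffice).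

Setting: flat torus `𝕋^d`, axis `i`, a jointly smooth divergence-free carrier `u` on `[a, b]` invariant
under the translations `x ↦ x + c eᵢ`, viscosity `ν > 0`, and a classical linearised solution `(w, q)`
whose datum `w(a)` is mean-zero with Fourier spectrum on the `i`-axis `{m eᵢ : m ∈ ℤ}` (a field
depending on `xᵢ` only, e.g. a residual comb `g(xᵢ) eⱼ`).  A **single streamwise harmonic** is the real
mode `x ↦ Re (e_{l eᵢ}(x) z) = Torus.realTrigPoly {l eᵢ} (fun _ ↦ z)` (`l ≥ 1`, `z ∈ ℂ^d`, `zᵢ = 0`),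
i.e. `cos(2πl xᵢ) Re z − sin(2πl xᵢ) Im z`.

* `Torus.realTrigPoly_single_add_single`, `Torus.realTrigPoly_single_negI_add_single` — a single
  harmonic and its quadrature companion `Re (e_{l eᵢ} (−i z))` satisfy the rotation relations of
  `TorusLinearisedNSShearModesFourier` under `x ↦ x + r eᵢ`.
* `Torus.realTrigPoly_single_apply_eq_cos_sin`, `Torus.realPart_negI_smul_apply` — the harmonic in
  coordinates: `Re (e_{l eᵢ}(x) z) = cos(2πl xᵢ) Re z − sin(2πl xᵢ) Re(−i z)`, `(Re(−i z))ⱼ = Im zⱼ`.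
* `Torus.isDivFree_realTrigPoly_single`, `Torus.hasZeroMean_realTrigPoly_single` — single harmonics with
  `zᵢ = 0`, `l ≠ 0` are divergence free and mean-zero (so `Torus.linearisedNS_exists` launches them).
* `Torus.fourierTruncate_eq_sum_harmonics` — for a mean-zero integrable field with spectrum on the
  `i`-axis, `P_N v = Σ_{l=1}^{N} Re (e_{l eᵢ} (2 v̂(l eᵢ)))`: a band-limited streamwise-only datum is a
  finite superposition of single harmonics.
* `Torus.mFourierCoeff_single_apply_eq_zero_of_isDivFree` — the harmonics `ŵ(l eᵢ)` of a divergence-free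
  field are transversal, `ŵ(l eᵢ)ᵢ = 0` (`l ≠ 0`).
* **`Torus.linearisedNS_integral_norm_sq_le_of_forall_harmonic`** — THE REDUCTION: if, for every `l ≥ 1`,
  every classical linearised solution on `[a, b]` along `u` launched from the `l`-th harmonic
  `Re (e_{l eᵢ} 2ŵ(a)(l eᵢ))` OF THE DATUM obeys `∫‖W(t)‖² ≤ K ∫‖W(a)‖²`, then so does `(w, q)`;
  primed form `…_of_forall_harmonic'`: the bound assumed for all harmonics `Re (e_{l eᵢ} z)`, `zᵢ = 0`.

Proof of the reduction: `P_N w(a)` is the superposition of the harmonics `l = 1, …, N` with vectors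
`2 ŵ(a)(l eᵢ)` (transversal because `w(a)` is divergence free); the harmonics and their companions
launch classical solutions (`Torus.linearisedNS_exists`), so
`Torus.linearisedNS_vectorL2Sq_le_of_datum_eq_finset_sum` bounds every solution launched from `P_N w(a)`,
and `Torus.linearisedNS_integral_norm_sq_le_of_forall_fourierTruncate` passes to `w`.

## Mathlib / tree search

Tree (reused): `Torus.mFourier_add_single` (`TorusAxisAverage`), `Torus.realTrigPoly_singleton_apply`,
`Torus.isDivFree_realTrigPoly_singleton`, `Torus.mFourierCoeff_realTrigPoly_singleton`,
`Torus.realTrigPoly_apply_eq_sum`, `Torus.mem_freqBall`, `Torus.fourierTruncate_eq`,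
`Torus.isConjSymm_mFourierCoeff`, `Torus.IsDivFree.sum_mul_mFourierCoeff_eq_zero`,
`Torus.linearisedNS_exists`, `Torus.linearisedNS_vectorL2Sq_le_of_datum_eq_finset_sum`,
`Torus.linearisedNS_integral_norm_sq_le_of_forall_fourierTruncate`, `Torus.linearisedNS_eq_zero`;
`lean search 'streamwise harmonic|realTrigPoly.*single.*add_single|fourierTruncate_eq_sum'`: nothing.

## References

* P. G. Drazin, *Introduction to Hydrodynamic Stability*, CUP 2002, §8.1 (8.9)–(8.11) (normal modes
  `e^{iαx}` of the linearised problem at a parallel flow) [held]. [`Drazin2002`]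
* J. Bedrossian, M. Coti Zelati, Arch. Ration. Mech. Anal. 224 (2017), §1 Thm 1.1 (mode-by-mode
  statements, projections `P_k`) [held: arXiv:1510.08098]. [`BedrossianCotiZelati2017`]
* J. C. Robinson, J. L. Rodrigo, W. Sadowski, *The Three-Dimensional Navier–Stokes Equations*, CUP 2016,
  §4.1, Lemma 4.1. [`RobinsonRodrigoSadowski2016`]
* L. Grafakos, *Classical Fourier Analysis*, GTM 249 (2014), Prop. 3.1.2 (5). [`Grafakos2014`]
-/

noncomputable section

open MeasureTheory Set Filter Function Complex UnitAddTorus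
open scoped ContDiff InnerProductSpace RealInnerProductSpace Topology

namespace Literature.Analysis.FluidPDE

open Literature.Analysis.FunctionSpaces

variable {d : Type*} [Fintype d] [DecidableEq d]

/-! ### Single streamwise harmonics: rotation under axis translations -/

omit [Fintype d] [DecidableEq d] in
/-- `e_l(r) = cos (2π l r) + i sin (2π l r)` on the unit circle. [folklore] -/
private theorem fourier_coe_eq_cos_add_sin (l : ℤ) (r : ℝ) :
    fourier l ((r : ℝ) : UnitAddCircle) =
      ((Real.cos (2 * Real.pi * l * r) : ℝ) : ℂ) + ((Real.sin (2 * Real.pi * l * r) : ℝ) : ℂ) * I := by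
  rw [fourier_coe_apply, Complex.ofReal_cos, Complex.ofReal_sin, ← Complex.exp_mul_I]
  congr 1
  push_cast
  ring

omit [DecidableEq d] in
/-- Real parts under a phase rotation: `Re ((c + s i) u) = c Re u − s Re (−i u)` coordinatewise. [folklore] -/
private theorem realPart_rot_smul (c s : ℝ) (u : EuclideanSpace ℂ d) :
    EuclideanSpace.realPart (((c : ℂ) + (s : ℂ) * I) • u) =
      c • EuclideanSpace.realPart u - s • EuclideanSpace.realPart ((-I) • u) := by
  ext j
  simp [EuclideanSpace.realPart_apply, Complex.mul_re, Complex.mul_im, sub_eq_add_neg]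

omit [DecidableEq d] in
/-- Real parts under a phase rotation, companion form: `Re ((c + s i) (−i u)) = s Re u + c Re (−i u)`. [folklore] -/
private theorem realPart_rot_smul_negI (c s : ℝ) (u : EuclideanSpace ℂ d) :
    EuclideanSpace.realPart (((c : ℂ) + (s : ℂ) * I) • ((-I) • u)) =
      s • EuclideanSpace.realPart u + c • EuclideanSpace.realPart ((-I) • u) := by
  ext j
  simp [EuclideanSpace.realPart_apply, Complex.mul_re, Complex.mul_im]

/-- **Rotation relation of a single streamwise harmonic.** For `k = l eᵢ` and `z ∈ ℂ^d`, the real mode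
`w₀ = Re (e_k z) = Torus.realTrigPoly {k} (fun _ ↦ z)` and its companion `w₀' = Re (e_k (−i z))` satisfy
`w₀(x + r eᵢ) = cos(2πlr) w₀(x) − sin(2πlr) w₀'(x)` (`e_k(x + r eᵢ) = e_l(r) e_k(x)`). [cite: Grafakos2014, Prop. 3.1.2 (5)] -/
theorem Torus.realTrigPoly_single_add_single (i : d) (l : ℤ) (z : EuclideanSpace ℂ d) (r : ℝ)
    (x : UnitAddTorus d) :
    Torus.realTrigPoly {Pi.single i l} (fun _ => z) (x + Pi.single i ((r : ℝ) : UnitAddCircle)) =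
      Real.cos (2 * Real.pi * l * r) • Torus.realTrigPoly {Pi.single i l} (fun _ => z) x -
        Real.sin (2 * Real.pi * l * r) • Torus.realTrigPoly {Pi.single i l} (fun _ => (-I) • z) x := by
  simp only [Torus.realTrigPoly_singleton_apply]
  rw [Torus.mFourier_add_single, Pi.single_eq_same, fourier_coe_eq_cos_add_sin, mul_smul,
    realPart_rot_smul, smul_comm (mFourier (Pi.single i l) x) (-I) z]

/-- **Rotation relation of the companion harmonic**: with `w₀ = Re (e_k z)`, `w₀' = Re (e_k (−i z))`,
`k = l eᵢ`: `w₀'(x + r eᵢ) = sin(2πlr) w₀(x) + cos(2πlr) w₀'(x)`. [cite: Grafakos2014, Prop. 3.1.2 (5)] -/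
theorem Torus.realTrigPoly_single_negI_add_single (i : d) (l : ℤ) (z : EuclideanSpace ℂ d) (r : ℝ)
    (x : UnitAddTorus d) :
    Torus.realTrigPoly {Pi.single i l} (fun _ => (-I) • z) (x + Pi.single i ((r : ℝ) : UnitAddCircle)) =
      Real.sin (2 * Real.pi * l * r) • Torus.realTrigPoly {Pi.single i l} (fun _ => z) x +
        Real.cos (2 * Real.pi * l * r) • Torus.realTrigPoly {Pi.single i l} (fun _ => (-I) • z) x := by
  simp only [Torus.realTrigPoly_singleton_apply]
  rw [Torus.mFourier_add_single, Pi.single_eq_same, fourier_coe_eq_cos_add_sin, mul_smul,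
    smul_comm (mFourier (Pi.single i l) x) (-I) z, realPart_rot_smul_negI]

omit [DecidableEq d] in
/-- `e_{l eᵢ}(x) = e_l(xᵢ)`: the character at an axis frequency only sees the `i`-th coordinate. [folklore] -/
private theorem mFourier_single_apply [DecidableEq d] (i : d) (l : ℤ) (x : UnitAddTorus d) :
    mFourier (Pi.single i l) x = (fourier l (x i) : ℂ) := by
  have hprod : mFourier (Pi.single i l) x = ∏ j, (fourier ((Pi.single i l : d → ℤ) j) (x j) : ℂ) := by
    simp only [mFourier, ContinuousMap.coe_mk]
  rw [hprod, Finset.prod_eq_single i (fun j _ hj => by rw [Pi.single_eq_of_ne hj, fourier_zero])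
    (fun h => absurd (Finset.mem_univ i) h), Pi.single_eq_same]

omit [Fintype d] [DecidableEq d] in
/-- The `i`-th coordinate of `x ∈ 𝕋^d` is the class of its representative `Torus.repr x i ∈ [0, 1)`. [folklore] -/
private theorem coe_repr_apply (x : UnitAddTorus d) (i : d) :
    ((Torus.repr x i : ℝ) : UnitAddCircle) = x i := by
  have h := congrFun (Torus.proj_repr x) i
  rwa [Torus.proj_apply] at h

/-- **A single streamwise harmonic in coordinates**: with `xᵢ ∈ [0, 1)` the representative coordinate
(`Torus.repr x i`), `Re (e_{l eᵢ}(x) z) = cos(2πl xᵢ) Re z − sin(2πl xᵢ) Re(−i z)`, and coordinatewise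
`Re z = (Re zⱼ)ⱼ`, `Re(−i z) = (Im zⱼ)ⱼ`: the harmonic is `cos(2πl xᵢ) A + sin(2πl xᵢ) B` with the real
vectors `A = Re z`, `B = −Im z`. [cite: Grafakos2014, Prop. 3.1.2 (5)] -/
theorem Torus.realTrigPoly_single_apply_eq_cos_sin (i : d) (l : ℤ) (z : EuclideanSpace ℂ d)
    (x : UnitAddTorus d) :
    Torus.realTrigPoly {Pi.single i l} (fun _ => z) x =
      Real.cos (2 * Real.pi * l * Torus.repr x i) • EuclideanSpace.realPart z -
        Real.sin (2 * Real.pi * l * Torus.repr x i) • EuclideanSpace.realPart ((-I) • z) := by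
  rw [Torus.realTrigPoly_singleton_apply, mFourier_single_apply, ← coe_repr_apply x i,
    fourier_coe_eq_cos_add_sin, realPart_rot_smul]

omit [Fintype d] [DecidableEq d] in
/-- Coordinates of the two real vectors of a harmonic: `(Re z)ⱼ = Re zⱼ`, `(Re (−i z))ⱼ = Im zⱼ`. [cite: Grafakos2014, Prop. 3.1.2 (5)] -/
theorem Torus.realPart_negI_smul_apply [Fintype d] (z : EuclideanSpace ℂ d) (j : d) :
    EuclideanSpace.realPart ((-I) • z) j = (z j).im := by
  simp [EuclideanSpace.realPart_apply]

/-! ### Single streamwise harmonics: divergence and mean -/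

/-- **Single harmonics with `zᵢ = 0` are divergence free**: `div Re (e_{l eᵢ} z) = 0` (`(l eᵢ) · z = l zᵢ = 0`). [cite: RobinsonRodrigoSadowski2016, Def. 2.1] -/
theorem Torus.isDivFree_realTrigPoly_single (i : d) (l : ℤ) {z : EuclideanSpace ℂ d} (hz : z i = 0) :
    Torus.IsDivFree (Torus.realTrigPoly {Pi.single i l} (fun _ => z)) := by
  refine Torus.isDivFree_realTrigPoly_singleton (Finset.sum_eq_zero fun j _ => ?_)
  by_cases hj : j = i
  · subst hj; simp [hz]
  · simp [Pi.single_eq_of_ne hj]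

omit [Fintype d] [DecidableEq d] in
/-- The companion vector `−i z` inherits `zᵢ = 0`. [folklore] -/
private theorem negI_smul_apply_eq_zero {i : d} {z : EuclideanSpace ℂ d} (hz : z i = 0) :
    ((-I) • z) i = 0 := by
  simp [hz]

omit [DecidableEq d] in
/-- A field whose zero Fourier mode vanishes is mean-zero: `complexify (∫ v) = 𝓕(complexify ∘ v)(0) = 0`. [folklore] -/
private theorem hasZeroMean_of_coeff_zero {v : UnitAddTorus d → EuclideanSpace ℝ d}
    (h0 : mFourierCoeff (EuclideanSpace.complexify ∘ v) 0 = 0) : Torus.HasZeroMean v := by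
  have h : mFourierCoeff (EuclideanSpace.complexify ∘ v) 0 = EuclideanSpace.complexify (∫ x, v x) := by
    rw [Torus.mFourierCoeff_eq_integral_volume, neg_zero, mFourier_zero]
    simp only [ContinuousMap.one_apply, one_smul, Function.comp_apply]
    exact EuclideanSpace.complexify.integral_comp_comm v
  rw [h] at h0
  exact EuclideanSpace.complexify_injective (h0.trans (map_zero _).symm)

/-- **Single harmonics with `l ≠ 0` are mean-zero**: the Fourier coefficients of `Re (e_k z)` live on
`{k, −k} ∌ 0`. [folklore] -/
private theorem hasZeroMean_realTrigPoly_single_aux {k : d → ℤ} (hk : k ≠ 0) (z : EuclideanSpace ℂ d) :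
    Torus.HasZeroMean (Torus.realTrigPoly {k} (fun _ => z)) := by
  refine hasZeroMean_of_coeff_zero ?_
  rw [Torus.mFourierCoeff_realTrigPoly_singleton, if_neg (Ne.symm hk),
    if_neg (fun h => hk (neg_eq_zero.1 h.symm))]
  simp

/-- **Single streamwise harmonics with `l ≠ 0` are mean-zero.** [cite: Grafakos2014, Prop. 3.1.2 (5)] -/
theorem Torus.hasZeroMean_realTrigPoly_single (i : d) {l : ℤ} (hl : l ≠ 0) (z : EuclideanSpace ℂ d) :
    Torus.HasZeroMean (Torus.realTrigPoly {Pi.single i l} (fun _ => z)) :=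
  hasZeroMean_realTrigPoly_single_aux (fun h => hl (by simpa using congrFun h i)) z

/-! ### Band-limited streamwise-only data are finite superpositions of single harmonics -/

omit [DecidableEq d] in
/-- `|l eᵢ|² = l²`. [folklore] -/
private theorem freqNormSq_single [DecidableEq d] (i : d) (l : ℤ) :
    Torus.freqNormSq (Pi.single i l : d → ℤ) = (l : ℝ) ^ 2 := by
  unfold Torus.freqNormSq
  rw [Finset.sum_eq_single i (fun j _ hj => by rw [Pi.single_eq_of_ne hj, Int.cast_zero, zero_pow two_ne_zero])
    (fun h => absurd (Finset.mem_univ i) h), Pi.single_eq_same]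

omit [DecidableEq d] in
/-- `Re (e_{−k} z̄) = Re (e_k z)`: the two halves of a conj-symmetric pair have the same real part. [folklore] -/
private theorem realPart_mFourier_neg_smul_conjVec (k : d → ℤ) (z : EuclideanSpace ℂ d) (x : UnitAddTorus d) :
    EuclideanSpace.realPart (mFourier (-k) x • EuclideanSpace.conjVec z) =
      EuclideanSpace.realPart (mFourier k x • z) := by
  have h : mFourier (-k) x • EuclideanSpace.conjVec z = EuclideanSpace.conjVec (mFourier k x • z) := by
    rw [EuclideanSpace.conjVec_smul, mFourier_neg]
  rw [h, EuclideanSpace.realPart_conjVec]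

/-- **`P_N` of a mean-zero streamwise-only field is a finite superposition of single harmonics**:
if `v : 𝕋^d → ℝ^d` is integrable with `v̂(0) = 0` and `v̂(k) = 0` unless `k = kᵢ eᵢ`, then
`P_N v = Σ_{l=1}^{N} Re (e_{l eᵢ} (2 v̂(l eᵢ)))`. [cite: RobinsonRodrigoSadowski2016, §4.1 (P_n u = Σ_{|k|≤n} û_k e^{ik·x})] -/
theorem Torus.fourierTruncate_eq_sum_harmonics {v : UnitAddTorus d → EuclideanSpace ℝ d}
    (hv : Integrable v volume) (i : d)
    (hax : ∀ k : d → ℤ, k ≠ Pi.single i (k i) → mFourierCoeff (EuclideanSpace.complexify ∘ v) k = 0)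
    (h0 : mFourierCoeff (EuclideanSpace.complexify ∘ v) 0 = 0) (N : ℕ) (x : UnitAddTorus d) :
    Torus.fourierTruncate N v x =
      ∑ l ∈ Finset.Icc 1 N, Torus.realTrigPoly {Pi.single i (l : ℤ)}
        (fun _ => (2 : ℂ) • mFourierCoeff (EuclideanSpace.complexify ∘ v) (Pi.single i (l : ℤ))) x := by
  classical
  set c : (d → ℤ) → EuclideanSpace ℂ d := fun k => mFourierCoeff (EuclideanSpace.complexify ∘ v) k
    with hc
  have hcs : Torus.IsConjSymm c := Torus.isConjSymm_mFourierCoeff hv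
  set f : (d → ℤ) → EuclideanSpace ℝ d := fun k => EuclideanSpace.realPart (mFourier k x • c k) with hf
  -- the two half-axes inside the ball
  set T₁ : Finset (d → ℤ) := (Finset.Icc 1 N).image fun l : ℕ => Pi.single i (l : ℤ) with hT₁
  set T₂ : Finset (d → ℤ) := (Finset.Icc 1 N).image fun l : ℕ => -Pi.single i (l : ℤ) with hT₂
  have hinj₁ : Set.InjOn (fun l : ℕ => (Pi.single i (l : ℤ) : d → ℤ)) (Finset.Icc 1 N : Set ℕ) := by
    intro l _ l' _ h
    have := congrFun h i
    simpa using this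
  have hinj₂ : Set.InjOn (fun l : ℕ => (-Pi.single i (l : ℤ) : d → ℤ)) (Finset.Icc 1 N : Set ℕ) := by
    intro l _ l' _ h
    have := congrFun h i
    simpa using this
  have hdisj : Disjoint T₁ T₂ := by
    rw [Finset.disjoint_left]
    intro k hk₁ hk₂
    rw [hT₁, Finset.mem_image] at hk₁
    rw [hT₂, Finset.mem_image] at hk₂
    obtain ⟨l, hl, rfl⟩ := hk₁
    obtain ⟨l', hl', h⟩ := hk₂
    have h' := congrFun h i
    simp only [Pi.neg_apply, Pi.single_eq_same] at h'
    rw [Finset.mem_Icc] at hl hl'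
    omega
  have hsub : T₁ ∪ T₂ ⊆ Torus.freqBall N := by
    intro k hk
    rw [Finset.mem_union, hT₁, hT₂, Finset.mem_image, Finset.mem_image] at hk
    rw [Torus.mem_freqBall]
    rcases hk with ⟨l, hl, rfl⟩ | ⟨l, hl, rfl⟩
    · rw [freqNormSq_single]
      rw [Finset.mem_Icc] at hl
      exact_mod_cast Nat.pow_le_pow_left hl.2 2
    · rw [Torus.freqNormSq_neg, freqNormSq_single]
      rw [Finset.mem_Icc] at hl
      exact_mod_cast Nat.pow_le_pow_left hl.2 2
  -- terms of the ball outside `T₁ ∪ T₂` vanish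
  have hvanish : ∀ k ∈ Torus.freqBall N, k ∉ T₁ ∪ T₂ → f k = 0 := by
    intro k hk hkT
    by_cases hkax : k = Pi.single i (k i)
    · -- on the axis: `k = m eᵢ` with `m² ≤ N²`
      set m : ℤ := k i with hm
      have hmsq : (m : ℝ) ^ 2 ≤ (N : ℝ) ^ 2 := by
        have := Torus.mem_freqBall.1 hk
        rwa [hkax, freqNormSq_single] at this
      have habs : -(N : ℝ) ≤ (m : ℝ) ∧ (m : ℝ) ≤ N := abs_le_of_sq_le_sq' hmsq (Nat.cast_nonneg N)
      have hmN : -(N : ℤ) ≤ m ∧ m ≤ N := ⟨by exact_mod_cast habs.1, by exact_mod_cast habs.2⟩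
      rcases lt_trichotomy m 0 with hneg | hzero | hpos
      · exfalso
        refine hkT (Finset.mem_union_right _ ?_)
        rw [hT₂, Finset.mem_image]
        refine ⟨m.natAbs, ?_, ?_⟩
        · rw [Finset.mem_Icc]; omega
        · rw [hkax]
          have : ((m.natAbs : ℕ) : ℤ) = -m := by omega
          rw [this, Pi.single_neg, neg_neg]
      · rw [hf]
        simp only
        rw [hkax, hzero]
        have : (Pi.single i (0 : ℤ) : d → ℤ) = 0 := Pi.single_zero i
        rw [this]
        change EuclideanSpace.realPart (mFourier 0 x • mFourierCoeff (EuclideanSpace.complexify ∘ v) 0) = 0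
        rw [h0, smul_zero, map_zero]
      · exfalso
        refine hkT (Finset.mem_union_left _ ?_)
        rw [hT₁, Finset.mem_image]
        refine ⟨m.natAbs, ?_, ?_⟩
        · rw [Finset.mem_Icc]; omega
        · rw [hkax]
          have : ((m.natAbs : ℕ) : ℤ) = m := by omega
          rw [this]
    · rw [hf]
      simp only
      rw [show c k = 0 from hax k hkax, smul_zero, map_zero]
  -- assemble
  rw [Torus.fourierTruncate_eq, Torus.realTrigPoly_apply_eq_sum, ← Finset.sum_subset hsub hvanish,
    Finset.sum_union hdisj, hT₁, hT₂, Finset.sum_image hinj₁, Finset.sum_image hinj₂,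
    ← Finset.sum_add_distrib]
  refine Finset.sum_congr rfl fun l _ => ?_
  have hsymm : mFourierCoeff (EuclideanSpace.complexify ∘ v) (-Pi.single i (l : ℤ)) =
      EuclideanSpace.conjVec (mFourierCoeff (EuclideanSpace.complexify ∘ v) (Pi.single i (l : ℤ))) :=
    hcs _
  simp only [hf, hc, Torus.realTrigPoly_singleton_apply]
  rw [hsymm, realPart_mFourier_neg_smul_conjVec, two_smul, smul_add, map_add]

/-- The streamwise harmonics of a smooth divergence-free field are transversal to the axis:
`(v̂(l eᵢ))ᵢ = 0` for `l ≠ 0` (`(l eᵢ) · v̂(l eᵢ) = l v̂(l eᵢ)ᵢ = 0`). [cite: RobinsonRodrigoSadowski2016, Def. 2.1] -/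
theorem Torus.mFourierCoeff_single_apply_eq_zero_of_isDivFree {v : UnitAddTorus d → EuclideanSpace ℝ d}
    (hv : Torus.IsSmooth v) (hdiv : Torus.IsDivFree v) (i : d) {l : ℤ} (hl : l ≠ 0) :
    mFourierCoeff (EuclideanSpace.complexify ∘ v) (Pi.single i l) i = 0 := by
  have h := hdiv.sum_mul_mFourierCoeff_eq_zero hv (Pi.single i l)
  rw [Finset.sum_eq_single i (fun j _ hj => by rw [Pi.single_eq_of_ne hj, Int.cast_zero, zero_mul])
    (fun h' => absurd (Finset.mem_univ i) h'), Pi.single_eq_same] at h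
  have hl0 : (l : ℂ) ≠ 0 := by exact_mod_cast hl
  exact (mul_eq_zero.1 h).resolve_left hl0

/-! ### The reduction to one streamwise harmonic -/

section Reduction

variable {a b ν : ℝ} {i : d} {u w : ℝ → UnitAddTorus d → EuclideanSpace ℝ d}
  {q : ℝ → UnitAddTorus d → ℝ}

/-- **Reduction of `L²` growth bounds for streamwise-only data to ONE streamwise harmonic.** Let `u` be a
jointly smooth divergence-free carrier on `[a, b] × 𝕋^d` (`a < b`, `ν > 0`) invariant under the
translations along the `i`-th axis, and `(w, q)` a classical solution of the linearised Navier–Stokes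
system along `u` whose datum `w(a)` is mean-zero with Fourier spectrum on the `i`-axis (`ŵ(a)(k) = 0`
unless `k = kᵢ eᵢ`).  If for every `l ≥ 1` and every `z ∈ ℂ^d` with `zᵢ = 0`, every classical linearised
solution `(W, Q)` on `[a, b]` along `u` launched from the single harmonic `Re (e_{l eᵢ} z)` obeys
`∫‖W(t)‖² ≤ K ∫‖W(a)‖²` (`K ≥ 0`, `t ∈ [a, b]` fixed), then `∫‖w(t)‖² ≤ K ∫‖w(a)‖²`.  (Band-limited data
suffice by `Torus.linearisedNS_integral_norm_sq_le_of_forall_fourierTruncate`; `P_N w(a)` is the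
superposition of the harmonics `l = 1..N` with the transversal vectors `2ŵ(a)(l eᵢ)`
(`Torus.fourierTruncate_eq_sum_harmonics`), whose solutions and quadrature companions exist
(`Torus.linearisedNS_exists`) and are mutually `L²`-orthogonal for all times
(`Torus.linearisedNS_vectorL2Sq_le_of_datum_eq_finset_sum`).) [cite: Drazin2002, §8.1 (8.9)-(8.11) (normal modes in x at a parallel flow)] [cite: BedrossianCotiZelati2017, §1 Thm 1.1 (mode-by-mode statements)] -/
theorem Torus.linearisedNS_integral_norm_sq_le_of_forall_harmonic (hν : 0 < ν) (hab : a < b)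
    (hu : Torus.IsSmoothSpaceTimeOn (Icc a b) u) (hudiv : ∀ t ∈ Icc a b, Torus.IsDivFree (u t))
    (hinv : ∀ t ∈ Icc a b, ∀ (c : UnitAddCircle) (x : UnitAddTorus d), u t (x + Pi.single i c) = u t x)
    (hw : Torus.IsSmoothSpaceTimeOn (Icc a b) w) (hq : Torus.IsSmoothSpaceTimeOn (Icc a b) q)
    (hwdiv : ∀ t ∈ Icc a b, Torus.IsDivFree (w t))
    (hlin : ∀ t ∈ Icc a b, ∀ x, Torus.timeDerivWithin (Icc a b) w t x + Torus.convect (u t) (w t) x +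
      Torus.convect (w t) (u t) x = ν • Torus.laplacian (w t) x - Torus.gradient (q t) x)
    (hmean : Torus.HasZeroMean (w a))
    (hax : ∀ k : d → ℤ, k ≠ Pi.single i (k i) →
      mFourierCoeff (EuclideanSpace.complexify ∘ w a) k = 0)
    {K : ℝ} (hK0 : 0 ≤ K) {t : ℝ} (ht : t ∈ Icc a b)
    (hK : ∀ (l : ℕ), 1 ≤ l →
      ∀ (W : ℝ → UnitAddTorus d → EuclideanSpace ℝ d) (Q : ℝ → UnitAddTorus d → ℝ),
      Torus.IsSmoothSpaceTimeOn (Icc a b) W → Torus.IsSmoothSpaceTimeOn (Icc a b) Q →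
      (∀ s ∈ Icc a b, Torus.IsDivFree (W s)) →
      (∀ s ∈ Icc a b, ∀ x, Torus.timeDerivWithin (Icc a b) W s x + Torus.convect (u s) (W s) x +
        Torus.convect (W s) (u s) x = ν • Torus.laplacian (W s) x - Torus.gradient (Q s) x) →
      W a = Torus.realTrigPoly {Pi.single i (l : ℤ)}
        (fun _ => (2 : ℂ) • mFourierCoeff (EuclideanSpace.complexify ∘ w a) (Pi.single i (l : ℤ))) →
      ∫ x, ‖W t x‖ ^ 2 ≤ K * ∫ x, ‖W a x‖ ^ 2) :
    ∫ x, ‖w t x‖ ^ 2 ≤ K * ∫ x, ‖w a x‖ ^ 2 := by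
  classical
  have ha : a ∈ Icc a b := ⟨le_rfl, hab.le⟩
  have hwa : Torus.IsSmooth (w a) := hw.isSmooth_slice ha
  have hc0 : mFourierCoeff (EuclideanSpace.complexify ∘ w a) 0 = 0 :=
    Torus.mFourierCoeff_complexify_eq_zero_of_hasZeroMean hmean
  -- the mode vectors `z l = 2 ŵ(a)(l eᵢ)` are transversal
  set z : ℕ → EuclideanSpace ℂ d := fun l =>
    (2 : ℂ) • mFourierCoeff (EuclideanSpace.complexify ∘ w a) (Pi.single i (l : ℤ)) with hz
  have hzi : ∀ l : ℕ, 1 ≤ l → z l i = 0 := by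
    intro l hl
    have hci := Torus.mFourierCoeff_single_apply_eq_zero_of_isDivFree hwa (hwdiv a ha) i
      (show (l : ℤ) ≠ 0 by exact_mod_cast (by omega : l ≠ 0))
    simp [hz, hci]
  refine Torus.linearisedNS_integral_norm_sq_le_of_forall_fourierTruncate hν hab hu hudiv hw hq hwdiv
    hlin hmean hK0 ht ?_
  intro N W Q hW hQ hWdiv hWlin hW0
  -- `P_N w(a)` as a superposition of harmonics
  have hPN : W a = fun x => ∑ l ∈ Finset.Icc 1 N,
      Torus.realTrigPoly {Pi.single i (l : ℤ)} (fun _ => z l) x := by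
    rw [hW0]
    funext x
    exact Torus.fourierTruncate_eq_sum_harmonics hwa.integrable i hax hc0 N x
  rcases Nat.eq_zero_or_pos N with hN | hN
  · -- `N = 0`: the datum vanishes, so does the solution
    subst hN
    have hWa : W a = 0 := by
      rw [hPN]
      funext x
      simp
    have hWt : W t = 0 := Torus.linearisedNS_eq_zero hν.le hu hudiv hW hQ hWdiv hWlin hWa ht
    rw [hWt, hWa]
    simp
  -- `N ≥ 1`: modes and companions launched from the harmonics
  have hex : ∀ l : ℕ, ∃ (wl : ℝ → UnitAddTorus d → EuclideanSpace ℝ d) (ql : ℝ → UnitAddTorus d → ℝ)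
      (wl' : ℝ → UnitAddTorus d → EuclideanSpace ℝ d) (ql' : ℝ → UnitAddTorus d → ℝ), 1 ≤ l →
      (Torus.IsSmoothSpaceTimeOn (Icc a b) wl ∧ Torus.IsSmoothSpaceTimeOn (Icc a b) ql ∧
        (∀ s ∈ Icc a b, Torus.IsDivFree (wl s)) ∧
        (∀ s ∈ Icc a b, ∀ x, Torus.timeDerivWithin (Icc a b) wl s x + Torus.convect (u s) (wl s) x +
          Torus.convect (wl s) (u s) x = ν • Torus.laplacian (wl s) x - Torus.gradient (ql s) x) ∧
        wl a = Torus.realTrigPoly {Pi.single i (l : ℤ)} (fun _ => z l)) ∧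
      (Torus.IsSmoothSpaceTimeOn (Icc a b) wl' ∧ Torus.IsSmoothSpaceTimeOn (Icc a b) ql' ∧
        (∀ s ∈ Icc a b, Torus.IsDivFree (wl' s)) ∧
        (∀ s ∈ Icc a b, ∀ x, Torus.timeDerivWithin (Icc a b) wl' s x + Torus.convect (u s) (wl' s) x +
          Torus.convect (wl' s) (u s) x = ν • Torus.laplacian (wl' s) x - Torus.gradient (ql' s) x) ∧
        wl' a = Torus.realTrigPoly {Pi.single i (l : ℤ)} (fun _ => (-I) • z l)) := by
    intro l
    rcases Nat.eq_zero_or_pos l with hl | hl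
    · exact ⟨0, 0, 0, 0, fun h => absurd h (by omega)⟩
    · have hlz : (l : ℤ) ≠ 0 := by exact_mod_cast hl.ne'
      obtain ⟨wl, ql, h1, h2, h3, -, -, h4, h5⟩ := Torus.linearisedNS_exists hν hab hu hudiv
        (Torus.isSmooth_realTrigPoly _ _) (Torus.isDivFree_realTrigPoly_single i (l : ℤ) (hzi l hl))
        (Torus.hasZeroMean_realTrigPoly_single i hlz (z l))
      obtain ⟨wl', ql', h1', h2', h3', -, -, h4', h5'⟩ := Torus.linearisedNS_exists hν hab hu hudiv
        (Torus.isSmooth_realTrigPoly _ _)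
        (Torus.isDivFree_realTrigPoly_single i (l : ℤ) (negI_smul_apply_eq_zero (hzi l hl)))
        (Torus.hasZeroMean_realTrigPoly_single i hlz ((-I) • z l))
      exact ⟨wl, ql, wl', ql', fun _ => ⟨⟨h1, h2, h3, h4, h5⟩, ⟨h1', h2', h3', h4', h5'⟩⟩⟩
  choose wm qm wm' qm' hspec using hex
  have hmem : ∀ l ∈ Finset.Icc 1 N, 1 ≤ l := fun l hl => (Finset.mem_Icc.1 hl).1
  have hs : (Finset.Icc 1 N).Nonempty := ⟨1, Finset.mem_Icc.2 ⟨le_rfl, hN⟩⟩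
  have h0 : W a = fun x => ∑ l ∈ Finset.Icc 1 N, wm l a x := by
    rw [hPN]
    funext x
    exact Finset.sum_congr rfl fun l hl => by rw [((hspec l (hmem l hl)).1).2.2.2.2]
  exact Torus.linearisedNS_vectorL2Sq_le_of_datum_eq_finset_sum hν.le hab hu hudiv hinv hs
    (fun l hl => ((hspec l (hmem l hl)).1).1) (fun l hl => ((hspec l (hmem l hl)).1).2.1)
    (fun l hl => ((hspec l (hmem l hl)).1).2.2.1) (fun l hl => ((hspec l (hmem l hl)).1).2.2.2.1)
    (fun l hl => ((hspec l (hmem l hl)).2).1) (fun l hl => ((hspec l (hmem l hl)).2).2.1)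
    (fun l hl => ((hspec l (hmem l hl)).2).2.2.1) (fun l hl => ((hspec l (hmem l hl)).2).2.2.2.1)
    (fun l hl r x => by
      rw [((hspec l (hmem l hl)).1).2.2.2.2, ((hspec l (hmem l hl)).2).2.2.2.2]
      simpa [Int.cast_natCast] using Torus.realTrigPoly_single_add_single i (l : ℤ) (z l) r x)
    (fun l hl r x => by
      rw [((hspec l (hmem l hl)).1).2.2.2.2, ((hspec l (hmem l hl)).2).2.2.2.2]
      simpa [Int.cast_natCast] using Torus.realTrigPoly_single_negI_add_single i (l : ℤ) (z l) r x)
    hW hQ hWdiv hWlin h0 ht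
    (fun l hl => hK l (hmem l hl) (wm l) (qm l) ((hspec l (hmem l hl)).1).1
      ((hspec l (hmem l hl)).1).2.1 ((hspec l (hmem l hl)).1).2.2.1 ((hspec l (hmem l hl)).1).2.2.2.1
      ((hspec l (hmem l hl)).1).2.2.2.2)

/-- **Reduction to one streamwise harmonic, convenient form**: as
`Torus.linearisedNS_integral_norm_sq_le_of_forall_harmonic`, with the single-harmonic bound assumed for
ALL harmonics `Re (e_{l eᵢ} z)`, `l ≥ 1`, `z ∈ ℂ^d` with `zᵢ = 0` (the harmonics of a divergence-free
streamwise-only datum are of this form). [cite: Drazin2002, §8.1 (8.9)-(8.11) (normal modes in x at a parallel flow)] -/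
theorem Torus.linearisedNS_integral_norm_sq_le_of_forall_harmonic' (hν : 0 < ν) (hab : a < b)
    (hu : Torus.IsSmoothSpaceTimeOn (Icc a b) u) (hudiv : ∀ t ∈ Icc a b, Torus.IsDivFree (u t))
    (hinv : ∀ t ∈ Icc a b, ∀ (c : UnitAddCircle) (x : UnitAddTorus d), u t (x + Pi.single i c) = u t x)
    (hw : Torus.IsSmoothSpaceTimeOn (Icc a b) w) (hq : Torus.IsSmoothSpaceTimeOn (Icc a b) q)
    (hwdiv : ∀ t ∈ Icc a b, Torus.IsDivFree (w t))
    (hlin : ∀ t ∈ Icc a b, ∀ x, Torus.timeDerivWithin (Icc a b) w t x + Torus.convect (u t) (w t) x +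
      Torus.convect (w t) (u t) x = ν • Torus.laplacian (w t) x - Torus.gradient (q t) x)
    (hmean : Torus.HasZeroMean (w a))
    (hax : ∀ k : d → ℤ, k ≠ Pi.single i (k i) →
      mFourierCoeff (EuclideanSpace.complexify ∘ w a) k = 0)
    {K : ℝ} (hK0 : 0 ≤ K) {t : ℝ} (ht : t ∈ Icc a b)
    (hK : ∀ (l : ℕ), 1 ≤ l → ∀ (z : EuclideanSpace ℂ d), z i = 0 →
      ∀ (W : ℝ → UnitAddTorus d → EuclideanSpace ℝ d) (Q : ℝ → UnitAddTorus d → ℝ),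
      Torus.IsSmoothSpaceTimeOn (Icc a b) W → Torus.IsSmoothSpaceTimeOn (Icc a b) Q →
      (∀ s ∈ Icc a b, Torus.IsDivFree (W s)) →
      (∀ s ∈ Icc a b, ∀ x, Torus.timeDerivWithin (Icc a b) W s x + Torus.convect (u s) (W s) x +
        Torus.convect (W s) (u s) x = ν • Torus.laplacian (W s) x - Torus.gradient (Q s) x) →
      W a = Torus.realTrigPoly {Pi.single i (l : ℤ)} (fun _ => z) →
      ∫ x, ‖W t x‖ ^ 2 ≤ K * ∫ x, ‖W a x‖ ^ 2) :
    ∫ x, ‖w t x‖ ^ 2 ≤ K * ∫ x, ‖w a x‖ ^ 2 := by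
  have ha : a ∈ Icc a b := ⟨le_rfl, hab.le⟩
  refine Torus.linearisedNS_integral_norm_sq_le_of_forall_harmonic hν hab hu hudiv hinv hw hq hwdiv hlin
    hmean hax hK0 ht fun l hl => hK l hl _ ?_
  have hci := Torus.mFourierCoeff_single_apply_eq_zero_of_isDivFree (hw.isSmooth_slice ha) (hwdiv a ha) i
    (show (l : ℤ) ≠ 0 by exact_mod_cast (by omega : l ≠ 0))
  simp [hci]

end Reduction

end Literature.Analysis.FluidPDE

end
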